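import Literature.AlgebraicGeometry.Motives.MorphismsToProjectiveSpace
import Literature.AlgebraicGeometry.Morphisms.CechH1Projective
import HarnessLib

/-!
# [OURS · L1 W4.5(b) · LINE (T-j)-PROOF] BRICK S5a — the morphism `C → ℙ¹_O` glued from a coordinate pair
# (F-102 `GenusZeroOverCompleteDVR_holds`, res-L1-w45b-lead-2's skeleton `L/res-L1-w45b-lead-2/F102Skeleton.lean` ecade93244d6930c,
# brick S5 `exists_morphism_PP`, first half; crux `EquisingularLiftNatThree` stmt-ResolutionOfSingularities-20148, residue (T-j))

NOT a statement of any manuscript. Helper file of the chain res-L1-w45b (cell `res-hironaka`, slot W4.5(b)); OURS; AI-written, weaker than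
expert review; `--supports stmt-ResolutionOfSingularities-20148 --as helper` by res-L1-w45b-stub-3 g7 (lead-2 PUBLISHED 2026-08-27T21:33:46Z:
«S5 — OPEN (ProjCech-fluent hand; stub-3 g7 if willing)»). No `sorry`; standard axioms; no definitions.

WHAT (namespace `…Cruxes.EquisingularLiftNat.F102`, the skeleton's).
* `ι_appLE_self_top`, `appLE_comp_ι_top` — `appLE` bookkeeping for the inclusion of an open.
* **`awayToSection_appLE_toProj`** — THE CHART MAP OF `Motives.GeneratingSections.toProj` ON SECTIONS: for generating-sections data `D`
  on `Y` over `k` (tree `Literature/AlgebraicGeometry/Motives/MorphismsToProjectiveSpace`, Hartshorne II Thm. 7.1) and `φ = D.toProj f`,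
  `awayToSection ≫ φ.appLE (D₊(xᵢ)) (U i) _ = D.sectionsRingHom f i` — i.e. on the standard chart the map on sections
  `Γ(ℙ(ι)_k, D₊(xᵢ)) → Γ(Y, U i)` IS `x_j/x_i ↦ s_j/s_i` up to Mathlib's `(k[x]_{(xᵢ)})₀ ≅ Γ(ℙ(ι), D₊(xᵢ))` (`Proj.basicOpenIsoAway`).
  (General `ι`, `k`; the missing Γ-level companion of the tree's `chart_eq` / `toProj_preimage_basicOpen`.)
* **`exists_toPP_of_coordinatePair`** — BRICK S5a: from a COORDINATE PAIR (`U₀ ∪ U₁ = C`, `t₁ ∈ Γ(U₀)`, `t₀ ∈ Γ(U₁)`, each a unit exactly on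
  `U₀ ∩ U₁`, `t₁ t₀ = 1` there) a morphism `φ : C → ProjCech.PP O 1` OVER `f` with `φ⁻¹D₊(x₀) = U₀`, `φ⁻¹D₊(x₁) = U₁` and, for both charts,
  `range (φ.appLE (D₊(xᵢ)) (Uᵢ)) = Subring.closure (constants from O ∪ {t})` («`φ♯(x₁/x₀) = t₁`, `φ♯(x₀/x₁) = t₀`» in the form S6/S7 use).
* `sup_eq_top_of_compl_of_disjoint`, **`basicOpen_eq_inf_of_ker_ideal_eq_span`** — the translation from BRICK B4's currency (two disjoint
  sections `s_j`, `W_j = C ∖ s_j`, `t_j` generating `s_{1-j}.ker` on affine opens of `W_j`): the `W_j` cover, and `C_{t_j} = W_j ∩ W_{1-j}`.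

What S5 still needs (BRICK S5b, next file): the two special-fibre conjuncts of the skeleton's `exists_morphism_PP` — fibres over the closed
fibre are subsingletons and the chart maps are surjective modulo `ϖ` — from «`t̄₁ ∈ Γ(C_k ∖ z₁, 𝒪) = k[u]` has a single simple zero (at `z₀`)
⇒ `t̄₁` is an affine coordinate».

References: R. Hartshorne, *Algebraic Geometry* (1977), II Thm. 7.1 and its proof [cite: Hartshorne1977]; The Stacks Project, Tag 01O4
(morphisms into Proj) [cite: StacksProject]. Tree: `Motives.GeneratingSections` (`toProj`, `toProj_toSpec`, `toProj_preimage_basicOpen`,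
`chart_eq`, `range_sectionsRingHom`), `Morphisms.ProjCech` (`PP`, `toSpec`), Mathlib `Proj.awayToSection`, `Proj.basicOpenToSpec_app_top`.
-/

set_option linter.dupNamespace false

noncomputable section

open CategoryTheory AlgebraicGeometry TopologicalSpace Opposite
open MvPolynomial (X C)
open Literature.AlgebraicGeometry.Motives Literature.AlgebraicGeometry.Motives.Segre
open Literature.AlgebraicGeometry.Morphisms (ProjCech.PP ProjCech.toSpec)

attribute [local instance] MvPolynomial.gradedAlgebra

namespace Summit.ResolutionOfSingularities.ResolutionOfSingularities.Cruxes.EquisingularLiftNat.F102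

universe u


/-- For an open `U ⊆ X`, the inclusion's `appLE U ⊤` is the identification `Γ(X, U) ≅ Γ(U, ⊤)`. [folklore] -/
theorem ι_appLE_self_top {X : Scheme.{u}} (U : X.Opens) :
    U.ι.appLE U ⊤ (by rw [Scheme.Opens.ι_preimage_self]) = U.topIso.inv := by
  rw [Scheme.Opens.ι_appLE, Scheme.Opens.topIso_inv]
  exact congrArg (fun q ↦ X.presheaf.map (Quiver.Hom.op q)) (Subsingleton.elim _ _)

/-- For a morphism `g : T ⟶ V` into an open `V ⊆ Z` followed by the inclusion, `appLE V ⊤` is `V.topIso.inv ≫ g.appTop`.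
[folklore] -/
theorem appLE_comp_ι_top {T Z : Scheme.{u}} (V : Z.Opens) (g : T ⟶ (V : Scheme.{u}))
    (e : (⊤ : T.Opens) ≤ (g ≫ V.ι) ⁻¹ᵁ V) :
    (g ≫ V.ι).appLE V ⊤ e = V.topIso.inv ≫ g.appTop := by
  rw [← ι_appLE_self_top V, ← GeneratingSections.appLE_top_top g le_top]
  exact (Scheme.Hom.appLE_comp_appLE g V.ι V ⊤ ⊤ _ _).symm

/-- **The chart ring map of `GeneratingSections.toProj` on sections.** For generating-sections data `D` on `Y` over `k` and the
morphism `φ = D.toProj f : Y → ℙ(ι)_k`: on the standard open `D₊(xᵢ)` (whose preimage is `U i`), the map on sections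
`Γ(ℙ(ι), D₊(xᵢ)) → Γ(Y, U i)` composed with `(k[x]_{(xᵢ)})₀ ≅ Γ(ℙ(ι), D₊(xᵢ))` is the chart ring map `x_j/x_i ↦ s_j/s_i`
(`sectionsRingHom`; Hartshorne II, proof of Thm. 7.1). [cite: Hartshorne1977, II Thm. 7.1 (b)] -/
theorem awayToSection_appLE_toProj {ι : Type} {Y : Scheme.{u}} (D : GeneratingSections ι Y) {k : Type u} [CommRing k]
    (f : Y ⟶ Spec (.of k)) (i : ι) :
    Proj.awayToSection (grading ι k) (X i) ≫
        (D.toProj f).appLE (Proj.basicOpen (grading ι k) (X i)) (D.U i) (le_of_eq (D.toProj_preimage_basicOpen f i).symm) =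
      CommRingCat.ofHom (D.sectionsRingHom f i) := by
  have hpre : D.toProj f ⁻¹ᵁ Proj.basicOpen (grading ι k) (X i) = D.U i := D.toProj_preimage_basicOpen f i
  -- (1) push to `Γ(U i, ⊤)` along the mono `topIso.inv`
  rw [← cancel_mono (D.U i).topIso.inv, Category.assoc]
  have e₁ : (⊤ : (D.U i : Scheme.{u}).Opens) ≤ ((D.U i).ι ≫ D.toProj f) ⁻¹ᵁ Proj.basicOpen (grading ι k) (X i) := by
    rw [Scheme.Hom.comp_preimage, hpre, Scheme.Opens.ι_preimage_self]
  have h1 : (D.toProj f).appLE (Proj.basicOpen (grading ι k) (X i)) (D.U i) (le_of_eq hpre.symm) ≫ (D.U i).topIso.inv =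
      ((D.U i).ι ≫ D.toProj f).appLE (Proj.basicOpen (grading ι k) (X i)) ⊤ e₁ := by
    rw [← ι_appLE_self_top, Scheme.Hom.appLE_comp_appLE]
  rw [h1]
  -- (2) the restriction of `φ` to `U i` is the chart `toSpecΓ ≫ Spec (sectionsRingHom) ≫ (D₊ ≅ Spec)⁻¹ ≫ ι`
  set g : (D.U i : Scheme.{u}) ⟶ (Proj.basicOpen (grading ι k) (X i) : Scheme.{u}) :=
    (D.U i).toSpecΓ ≫ Spec.map (CommRingCat.ofHom (D.sectionsRingHom f i)) ≫
      (Proj.basicOpenIsoSpec (grading ι k) (X i) (X_mem k i) zero_lt_one).inv with hg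
  have hchart : (D.U i).ι ≫ D.toProj f = g ≫ (Proj.basicOpen (grading ι k) (X i)).ι := by
    rw [D.ι_toProj f i, D.chart_eq f i, hg]
    simp only [Category.assoc, Segre.chartι, ← Proj.basicOpenIsoSpec_inv_ι]
  have e₂ : (⊤ : (D.U i : Scheme.{u}).Opens) ≤ (g ≫ (Proj.basicOpen (grading ι k) (X i)).ι) ⁻¹ᵁ
      Proj.basicOpen (grading ι k) (X i) := by
    rw [← hchart]; exact e₁
  have h2 : ((D.U i).ι ≫ D.toProj f).appLE (Proj.basicOpen (grading ι k) (X i)) ⊤ e₁ =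
      (g ≫ (Proj.basicOpen (grading ι k) (X i)).ι).appLE (Proj.basicOpen (grading ι k) (X i)) ⊤ e₂ := by
    congr 1
  rw [h2, appLE_comp_ι_top, hg]
  -- (3) compute the composite on global sections, after precomposing with the iso `ΓSpecIso`
  have hh' : (Scheme.ΓSpecIso _).hom ≫ Proj.awayToSection (grading ι k) (X i) ≫
      (Proj.basicOpen (grading ι k) (X i)).topIso.inv =
      (Proj.basicOpenIsoSpec (grading ι k) (X i) (X_mem k i) zero_lt_one).hom.appTop := by
    rw [Proj.basicOpenIsoSpec_hom]
    exact (Proj.basicOpenToSpec_app_top (grading ι k) (X i)).symm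
  have key : (Scheme.ΓSpecIso _).hom ≫ Proj.awayToSection (grading ι k) (X i) ≫
      (Proj.basicOpen (grading ι k) (X i)).topIso.inv ≫
        ((D.U i).toSpecΓ ≫ Spec.map (CommRingCat.ofHom (D.sectionsRingHom f i)) ≫
          (Proj.basicOpenIsoSpec (grading ι k) (X i) (X_mem k i) zero_lt_one).inv).appTop =
      (Scheme.ΓSpecIso _).hom ≫ CommRingCat.ofHom (D.sectionsRingHom f i) ≫ (D.U i).topIso.inv := by
    calc _ = (Proj.basicOpenIsoSpec (grading ι k) (X i) (X_mem k i) zero_lt_one).hom.appTop ≫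
          ((D.U i).toSpecΓ ≫ Spec.map (CommRingCat.ofHom (D.sectionsRingHom f i)) ≫
            (Proj.basicOpenIsoSpec (grading ι k) (X i) (X_mem k i) zero_lt_one).inv).appTop := by
            rw [← hh']; simp only [Category.assoc]
      _ = (((D.U i).toSpecΓ ≫ Spec.map (CommRingCat.ofHom (D.sectionsRingHom f i)) ≫
            (Proj.basicOpenIsoSpec (grading ι k) (X i) (X_mem k i) zero_lt_one).inv) ≫
            (Proj.basicOpenIsoSpec (grading ι k) (X i) (X_mem k i) zero_lt_one).hom).appTop :=
            (Scheme.Hom.comp_appTop _ _).symm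
      _ = ((D.U i).toSpecΓ ≫ Spec.map (CommRingCat.ofHom (D.sectionsRingHom f i))).appTop := by
            simp only [Category.assoc, Iso.inv_hom_id, Category.comp_id]
      _ = (Spec.map (CommRingCat.ofHom (D.sectionsRingHom f i))).appTop ≫ (D.U i).toSpecΓ.appTop :=
            Scheme.Hom.comp_appTop _ _
      _ = (Spec.map (CommRingCat.ofHom (D.sectionsRingHom f i))).appTop ≫ (Scheme.ΓSpecIso _).hom ≫
            (D.U i).topIso.inv := by rw [Scheme.Opens.toSpecΓ_appTop]; rfl
      _ = (Scheme.ΓSpecIso _).hom ≫ CommRingCat.ofHom (D.sectionsRingHom f i) ≫ (D.U i).topIso.inv := by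
            rw [← Category.assoc, Scheme.ΓSpecIso_naturality, Category.assoc]
  rw [← cancel_epi (Scheme.ΓSpecIso (CommRingCat.of (HomogeneousLocalization.Away (grading ι k) (X i)))).hom]
  simpa only [Category.assoc] using key


/-! ## The gluing -/

/-- **BRICK S5a (LINE (T-j)-PROOF, F-102) — the morphism `C → ℙ¹_O` of a COORDINATE PAIR.** Let `f : C → Spec O` and
`U₀ ∪ U₁ = C` two opens with sections `t₁ ∈ Γ(U₀)`, `t₀ ∈ Γ(U₁)` each invertible exactly on `U₀ ∩ U₁` and `t₁ t₀ = 1` there (the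
output of BRICK B4: `U₀ = C ∖ D₁`, `U₁ = C ∖ D₀`, `t_j` generating the other section's ideal). Then the generating-sections data
`(U, x₁/x₀ ↦ t₁, x₀/x₁ ↦ t₀)` glue (Hartshorne II Thm. 7.1, tree `Motives.GeneratingSections.toProj`) to a morphism
`φ : C → ℙ¹_O = Proj O[x₀,x₁]` OVER `f` with `φ⁻¹D₊(x₀) = U₀`, `φ⁻¹D₊(x₁) = U₁`, and on sections over the two standard charts the
image of `Γ(ℙ¹_O, D₊(x_i)) → Γ(C, U_i)` is EXACTLY the subring generated by the constants from `O` and `t` — the chart description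
the bricks S6/S7 consume («`φ♯(x₁/x₀) = t₁`, `φ♯(x₀/x₁) = t₀`»). [cite: Hartshorne1977, II Thm. 7.1 (b)] [OURS · L1 W4.5b · (T-j)] -/
theorem exists_toPP_of_coordinatePair (O : Type) [CommRing O] {C : Scheme.{0}} (f : C ⟶ Spec (.of O))
    (U₀ U₁ : C.Opens) (hcov : U₀ ⊔ U₁ = ⊤) (t₁ : Γ(C, U₀)) (t₀ : Γ(C, U₁))
    (hb₁ : C.basicOpen t₁ = U₀ ⊓ U₁) (hb₀ : C.basicOpen t₀ = U₀ ⊓ U₁)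
    (hmul : C.presheaf.map (homOfLE (inf_le_left : U₀ ⊓ U₁ ≤ U₀)).op t₁ *
      C.presheaf.map (homOfLE (inf_le_right : U₀ ⊓ U₁ ≤ U₁)).op t₀ = 1) :
    ∃ (φ : C ⟶ ProjCech.PP O 1) (h₀ : φ ⁻¹ᵁ Proj.basicOpen (grading (Fin 2) O) (X 0) = U₀)
      (h₁ : φ ⁻¹ᵁ Proj.basicOpen (grading (Fin 2) O) (X 1) = U₁), φ ≫ ProjCech.toSpec O 1 = f ∧
      (φ.appLE (Proj.basicOpen (grading (Fin 2) O) (X 0)) U₀ (le_of_eq h₀.symm)).hom.range =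
        Subring.closure (Set.range ((C.presheaf.map (homOfLE (le_top : U₀ ≤ ⊤)).op).hom.comp (pull f)) ∪ {t₁}) ∧
      (φ.appLE (Proj.basicOpen (grading (Fin 2) O) (X 1)) U₁ (le_of_eq h₁.symm)).hom.range =
        Subring.closure (Set.range ((C.presheaf.map (homOfLE (le_top : U₁ ≤ ⊤)).op).hom.comp (pull f)) ∪ {t₀}) := by
  let D : GeneratingSections (Fin 2) C :=
    { U := ![U₀, U₁]
      iSup_U := by
        rw [← top_le_iff, ← hcov, sup_le_iff]
        exact ⟨le_iSup (![U₀, U₁] : Fin 2 → C.Opens) 0, le_iSup (![U₀, U₁] : Fin 2 → C.Opens) 1⟩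
      ratio := fun i j => match i, j with
        | ⟨0, _⟩, ⟨0, _⟩ => 1
        | ⟨0, _⟩, ⟨1, _⟩ => t₁
        | ⟨1, _⟩, ⟨0, _⟩ => t₀
        | ⟨1, _⟩, ⟨1, _⟩ => 1
        | ⟨0, _⟩, ⟨n + 2, h⟩ => absurd h (by omega)
        | ⟨1, _⟩, ⟨n + 2, h⟩ => absurd h (by omega)
        | ⟨n + 2, h⟩, _ => absurd h (by omega)
      ratio_self := by
        intro i; fin_cases i <;> rfl
      basicOpen_ratio := by
        intro i j
        fin_cases i <;> fin_cases j
        · show C.basicOpen (1 : Γ(C, U₀)) = U₀ ⊓ U₀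
          rw [inf_idem]; exact C.basicOpen_of_isUnit isUnit_one
        · show C.basicOpen t₁ = U₀ ⊓ U₁
          exact hb₁
        · show C.basicOpen t₀ = U₁ ⊓ U₀
          rw [inf_comm]; exact hb₀
        · show C.basicOpen (1 : Γ(C, U₁)) = U₁ ⊓ U₁
          rw [inf_idem]; exact C.basicOpen_of_isUnit isUnit_one
      ratio_mul_ratio := by
        have hmul' : C.presheaf.map (homOfLE (inf_le_left : U₁ ⊓ U₀ ≤ U₁)).op t₀ *
            C.presheaf.map (homOfLE (inf_le_right : U₁ ⊓ U₀ ≤ U₀)).op t₁ = 1 := by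
          have key := congrArg (C.presheaf.map (homOfLE (le_of_eq (inf_comm U₁ U₀))).op).hom hmul
          rw [map_mul, map_one, ← CommRingCat.comp_apply, ← CommRingCat.comp_apply,
            ← Functor.map_comp, ← Functor.map_comp] at key
          rw [mul_comm]
          exact key
        intro i j l
        fin_cases i <;> fin_cases j <;> fin_cases l <;>
          (try simp only [map_one, one_mul, mul_one]) <;> first | done | rfl | exact hmul | exact hmul' }
  -- the range of a chart map: precompose the iso `(O[x]_{(xᵢ)})₀ ≅ Γ(ℙ¹, D₊(xᵢ))`, land on `sectionsRingHom`
  have hrange : ∀ i : Fin 2, ((D.toProj f).appLE (Proj.basicOpen (grading (Fin 2) O) (X i)) (D.U i)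
      (le_of_eq (D.toProj_preimage_basicOpen f i).symm)).hom.range =
      Subring.closure (Set.range (D.cstr f i) ∪ Set.range (D.ratio i)) := by
    intro i
    have hcomp : D.sectionsRingHom f i =
        ((D.toProj f).appLE (Proj.basicOpen (grading (Fin 2) O) (X i)) (D.U i)
          (le_of_eq (D.toProj_preimage_basicOpen f i).symm)).hom.comp
          (Proj.awayToSection (grading (Fin 2) O) (X i)).hom := by
      rw [← CommRingCat.hom_comp, awayToSection_appLE_toProj D f i, CommRingCat.hom_ofHom]
    have hsurj : Function.Surjective (Proj.awayToSection (grading (Fin 2) O) (X i)).hom := by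
      rw [← Proj.basicOpenIsoAway_hom (grading (Fin 2) O) (X i) (X_mem O i) zero_lt_one]
      exact (Proj.basicOpenIsoAway (grading (Fin 2) O) (X i) (X_mem O i) zero_lt_one).commRingCatIsoToRingEquiv.surjective
    rw [← D.range_sectionsRingHom f i, hcomp, ← RingHom.map_range, RingHom.range_eq_top.mpr hsurj,
      ← RingHom.range_eq_map]
  -- `Set.range (ratio i) = {1, t}`: the closure only needs `t`
  have hr0 : Subring.closure (Set.range (D.cstr f 0) ∪ Set.range (D.ratio 0)) =
      Subring.closure (Set.range ((C.presheaf.map (homOfLE (le_top : U₀ ≤ ⊤)).op).hom.comp (pull f)) ∪ {t₁}) := by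
    apply le_antisymm
    · refine Subring.closure_le.mpr ?_
      rintro x (hx | ⟨j, rfl⟩)
      · exact Subring.subset_closure (Or.inl hx)
      · fin_cases j
        · exact Subring.one_mem _
        · exact Subring.subset_closure (Or.inr rfl)
    · refine Subring.closure_mono ?_
      rintro x (hx | hx)
      · exact Or.inl hx
      · exact Or.inr ⟨1, hx.symm⟩
  have hr1 : Subring.closure (Set.range (D.cstr f 1) ∪ Set.range (D.ratio 1)) =
      Subring.closure (Set.range ((C.presheaf.map (homOfLE (le_top : U₁ ≤ ⊤)).op).hom.comp (pull f)) ∪ {t₀}) := by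
    apply le_antisymm
    · refine Subring.closure_le.mpr ?_
      rintro x (hx | ⟨j, rfl⟩)
      · exact Subring.subset_closure (Or.inl hx)
      · fin_cases j
        · exact Subring.subset_closure (Or.inr rfl)
        · exact Subring.one_mem _
    · refine Subring.closure_mono ?_
      rintro x (hx | hx)
      · exact Or.inl hx
      · exact Or.inr ⟨0, hx.symm⟩
  refine ⟨D.toProj f, D.toProj_preimage_basicOpen f 0, D.toProj_preimage_basicOpen f 1, D.toProj_toSpec f, ?_, ?_⟩
  · rw [← hr0]; exact hrange 0
  · rw [← hr1]; exact hrange 1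

/-! ## From BRICK B4's currency: the cover and the unit loci -/

/-- The complements of two disjoint section images cover `C`. [folklore] -/
theorem sup_eq_top_of_compl_of_disjoint {C : Scheme.{u}} {A B : Set C} (hAB : Disjoint A B) (W₀ W₁ : C.Opens)
    (hW₀ : (W₀ : Set C) = Aᶜ) (hW₁ : (W₁ : Set C) = Bᶜ) : W₀ ⊔ W₁ = ⊤ := by
  ext x
  simp only [Opens.coe_sup, Set.mem_union, SetLike.mem_coe, Opens.coe_top, Set.mem_univ, iff_true]
  by_cases hx : x ∈ A
  · right
    rw [← SetLike.mem_coe, hW₁, Set.mem_compl_iff]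
    exact fun hB => Set.disjoint_left.mp hAB hx hB
  · left
    rw [← SetLike.mem_coe, hW₀, Set.mem_compl_iff]
    exact hx

/-- **The unit locus of a local generator of a section's ideal.** For a quasi-compact `s : T → C` with CLOSED image (a section of a
separated `C → Spec O`), an open `W` and `t ∈ Γ(C, W)` generating the kernel ideal sheaf `s.ker` on every affine open `V ⊆ W`
(BRICK B4's output), `t` is invertible exactly on `W ∖ s(T)`: `C_t = W ⊓ W'` for the open `W' = C ∖ s(T)`. [folklore] -/
theorem basicOpen_eq_inf_of_ker_ideal_eq_span {C T : Scheme.{u}} (s : T ⟶ C) [QuasiCompact s]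
    (hcl : IsClosed (Set.range s)) (W W' : C.Opens) (hW' : (W' : Set C) = (Set.range s)ᶜ) (t : Γ(C, W))
    (hgen : ∀ V : C.affineOpens, ∀ hV : (V : C.Opens) ≤ W, s.ker.ideal V = Ideal.span {C.presheaf.map (homOfLE hV).op t}) :
    C.basicOpen t = W ⊓ W' := by
  have hsupp : (s.ker.support : Set C) = Set.range s := by
    rw [Scheme.Hom.support_ker, hcl.closure_eq]
  -- at a point of an affine `V ⊆ W`: `x ∈ supp (ker s) ↔ x ∉ C_t`
  have key : ∀ x ∈ W, x ∈ s.ker.support ↔ x ∉ C.basicOpen t := by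
    intro x hxW
    obtain ⟨V, hV, hxV, hVW⟩ := exists_isAffineOpen_mem_and_subset (X := C) (x := x) (U := W) hxW
    rw [Scheme.IdealSheafData.mem_support_iff_of_mem (U := ⟨V, hV⟩) hxV, hgen ⟨V, hV⟩ hVW,
      Scheme.zeroLocus_span, Scheme.zeroLocus_singleton, Set.mem_compl_iff, Scheme.basicOpen_res]
    change ¬ x ∈ V ⊓ C.basicOpen t ↔ _
    rw [Opens.mem_inf]
    exact ⟨fun h hx => h ⟨hxV, hx⟩, fun h hx => h hx.2⟩
  ext x
  change x ∈ (C.basicOpen t : Set C) ↔ x ∈ ((W ⊓ W' : C.Opens) : Set C)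
  rw [Opens.coe_inf, hW', Set.mem_inter_iff, Set.mem_compl_iff, ← hsupp, SetLike.mem_coe, SetLike.mem_coe,
    SetLike.mem_coe]
  constructor
  · intro hx
    have hxW : x ∈ W := C.basicOpen_le t hx
    exact ⟨hxW, fun h => (key x hxW).mp h hx⟩
  · rintro ⟨hxW, hxs⟩
    by_contra hx
    exact hxs ((key x hxW).mpr hx)

end Summit.ResolutionOfSingularities.ResolutionOfSingularities.Cruxes.EquisingularLiftNat.F102

end
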